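import Summits.CriticalPhenomena.PercolationContinuityZ3.Theorems.Transplant.SkelFrmFromBParamsFaceUnits
import Summits.CriticalPhenomena.PercolationContinuityZ3.Theorems.Transplant.SkelFrmBParamsFaceUnits
import Summits.CriticalPhenomena.PercolationContinuityZ3.Theorems.Transplant.PlanarCells2TDefs
import Summits.CriticalPhenomena.PercolationContinuityZ3.Theorems.Transplant.SkelPhiFaceNumsCross
import Summits.CriticalPhenomena.PercolationContinuityZ3.Theorems.Transplant.SkelNegBParamsFaceCountsA
import Summits.CriticalPhenomena.PercolationContinuityZ3.Theorems.Transplant.PlanarSkeletonFrmFromDefs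
import Summits.CriticalPhenomena.PercolationContinuityZ3.Theorems.Transplant.PlanarSkeletonFrmDefs
import Summits.CriticalPhenomena.PercolationContinuityZ3.Theorems.Transplant.SkelPhiStepIDataNS
import HarnessLib
import Summits.CriticalPhenomena.PercolationContinuityZ3.Theorems.Transplant.SkelFrmBParamsFaceCountsA
/-!
# U-WAVE PORT (RULING D-U, lead g21 2026-08-26; WAVE-U-MANIFEST v3.1 row «SkelFrmBParamsFaceCountsA» ↦ «SkelFrmFromBParamsFaceCountsA») of the tree module
# `Transplant/SkelFrmBParamsFaceCountsA` onto the carrier `PlanarSkeletonFrmFrom` (frames only, cylinders connected from width `ℓ₀` on)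

ORIGINAL TITLE: (F) VALUE LAYER, N2 twin (hp-8 g42, 2026-08-23; F-DISCHARGE-MAP-N2 G18 x-face counts, delta (Δ1)/(R-22)): `port_frm.py` text of N1 `SkelNegBParamsFaceCountsA` (p3-g12)

builds on p205010 (kernel theorem, internal audit signed; external expert review pending) — nothing in this file uses p205010; NOTHING is claimed about the
OPEN node U `SamePDropOfSkeletonFrmFrom₁` (nor U_s / the end state).  Lane `prim-bschramm`, seat `prim-bschramm-stmt` gen 26 (port pen, RULING M-11 family P-stmt; tool = p3-g26's port_u.py of record, registry-driven inputs); helper file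
(`--supports stmt-CriticalPhenomena-4575 --as helper`).  PORT RULES r1–r4 of RULING D-U: declaration order and proof texts are those of the original,
byte-identical except (i) the carrier token `PlanarSkeletonFrm ↦ PlanarSkeletonFrmFrom` (binders, `namespace`/`end` lines, qualified names of twinned
declarations), (ii) carrier-FREE declarations of the original (φ-level `Skelφ…` blocks and namespace-only arithmetic residents) are NOT re-declared —
this file imports the original and `export`s the twin-free residents (POLICY T / treatment (m1)); residents whose statement mentions a twinned
constant are copied, (iii) every carrier-binding declaration keeps its explicit binder `(Φ : PlanarSkeletonFrmFrom G)` in its own signature (r2).  Docstrings and citations are the original's.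
-/

noncomputable section

open scoped Classical

namespace Summit.CriticalPhenomena.PercolationContinuityZ3.Theorems.Transplant

namespace PlanarSkeletonFrmFrom

namespace NegB

open Literature.Probability.Percolation Literature.Probability.LatticeModels SimpleGraph
open Literature.Probability.Percolation.KozmaNitzan.Cells (oth sgOf sgOf_sign stepVec_apply_fst stepVec_apply_oth)
open SkelConc (Consts)
open Skelφ.StepI (DataN)
open TwoAxis.Para (modulus)
open Neg

namespace KS

section FaceCounts

export PlanarSkeletonFrm.NegB.KS (T0X)

export PlanarSkeletonFrm.NegB.KS (T1X)

/-- **The tangential sign**: towards the transverse target from the landing origin's ordinate reading. [this work] -/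
def σTX (κ : Consts) {V : Type} [DecidableEq V] [Countable V] {G : SimpleGraph V} [G.LocallyFinite] (Φ : PlanarSkeletonFrmFrom G) (t : V) (p : unitInterval) (D : Skelφ.StepI.DataNS V) (g : ℕ) (f : ℕ) (P : PCells2T) (yL x : Site 2) (du : MDir) (z : Site 2) : ℤ := if F1cA κ Φ t p D g f yL ≤ T1X P x du z then 1 else -1

/-- **The tangential count** `N3X := round(|T1X − F1cA yL|/u₁) − 1` (clipped at `0`). [this work] -/
def N3X (κ : Consts) {V : Type} [DecidableEq V] [Countable V] {G : SimpleGraph V} [G.LocallyFinite] (Φ : PlanarSkeletonFrmFrom G) (t : V) (p : unitInterval) (D : Skelφ.StepI.DataNS V) (g : ℕ) (f : ℕ) (P : PCells2T) (yL x : Site 2) (du : MDir) (z : Site 2) : ℕ :=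
  Int.toNat ((|T1X P x du z - F1cA κ Φ t p D g f yL| + u₁A κ Φ t p D g f / 2) / u₁A κ Φ t p D g f - 1)

/-- **The cross-shifted along origin** `yL + (σT·v_L, σT·h_L·v_L/n_L)` (`Skelφ.crossOffX` at zero strides). [this work] -/
def yTX0 (κ : Consts) {V : Type} [DecidableEq V] [Countable V] {G : SimpleGraph V} [G.LocallyFinite] (Φ : PlanarSkeletonFrmFrom G) (t : V) (p : unitInterval) (D : Skelφ.StepI.DataNS V) (g : ℕ) (f : ℕ) (yL : Site 2) (σT : ℤ) : Site 2 :=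
  yL + Skelφ.pt (σT * vL κ Φ t p D g f) (σT * hL κ Φ t p D g f * vL κ Φ t p D g f / (nL κ Φ t p D g f : ℤ))

/-- **The along count** `NrX := round(σ·(T0X − FcA(yTX0))/u₀) − 1` (clipped at `0`). [this work] -/
def NrX (κ : Consts) {V : Type} [DecidableEq V] [Countable V] {G : SimpleGraph V} [G.LocallyFinite] (Φ : PlanarSkeletonFrmFrom G) (t : V) (p : unitInterval) (D : Skelφ.StepI.DataNS V) (g : ℕ) (f : ℕ) (P : PCells2T) (yL : Site 2) (σT : ℤ) (x : Site 2) (du : MDir) (z : Site 2) : ℕ :=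
  Int.toNat ((sgOf du * (T0X P x du z - FcA κ Φ t p D g f (yTX0 κ Φ t p D g f yL σT)) + u₀A κ Φ t p D g f / 2) / u₀A κ Φ t p D g f - 1)

export PlanarSkeletonFrm.NegB.KS (T0X_eq)

export PlanarSkeletonFrm.NegB.KS (cenS_step_one)

/-- **One `u`-stride adds exactly `u₀` to the along reading**: `FcA (y + k·(n_L, h_L)) = FcA y + k·u₀` (`Λ₀` gains `k·m`, `A` cancels). [folklore] -/
theorem FcA_add_stride (κ : Consts) {V : Type} [DecidableEq V] [Countable V] {G : SimpleGraph V} [G.LocallyFinite] (Φ : PlanarSkeletonFrmFrom G) (t : V) (p : unitInterval) (D : Skelφ.StepI.DataNS V) (g : ℕ) (f : ℕ) (hN : EqNumL κ Φ t p D g f) (y : Site 2) (k : ℤ) :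
    FcA κ Φ t p D g f (y + Skelφ.pt (k * nL κ Φ t p D g f) (k * hL κ Φ t p D g f)) = FcA κ Φ t p D g f y + k * u₀A κ Φ t p D g f := by
  obtain ⟨hn1, hℓ1⟩ := one_le_of_eqNumL κ Φ t p D g f hN
  have hm : 0 < modulus (nL κ Φ t p D g f) (hL κ Φ t p D g f) (vL κ Φ t p D g f) (vβL κ Φ t p D g f) := Skelφ.NegPrm.modulus_vβOf_pos hn1 hℓ1 _ _
  rw [FcA_eq, FcA_eq]
  have hΛ : Λ₀of κ Φ t p D g f (y + Skelφ.pt (k * nL κ Φ t p D g f) (k * hL κ Φ t p D g f)) =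
      Λ₀of κ Φ t p D g f y + k * modulus (nL κ Φ t p D g f) (hL κ Φ t p D g f) (vL κ Φ t p D g f) (vβL κ Φ t p D g f) := by
    unfold Λ₀of vβL TwoAxis.Para.modulus
    simp only [Pi.add_apply, Skelφ.pt_zero, Skelφ.pt_one]
    ring
  rw [hΛ]
  set m := modulus (nL κ Φ t p D g f) (hL κ Φ t p D g f) (vL κ Φ t p D g f) (vβL κ Φ t p D g f)
  have e : 2 * u₀A κ Φ t p D g f * (Λ₀of κ Φ t p D g f y + k * m) + m = 2 * u₀A κ Φ t p D g f * Λ₀of κ Φ t p D g f y + m + k * u₀A κ Φ t p D g f * (2 * m) := by ring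
  rw [e, Int.add_mul_ediv_right _ _ (by linarith)]

/-- `crossOffX` splits into the zero-stride cross shift and `(Nr+1)` signed strides. [folklore] -/
theorem crossOffX_eq (κ : Consts) {V : Type} [DecidableEq V] [Countable V] {G : SimpleGraph V} [G.LocallyFinite] (Φ : PlanarSkeletonFrmFrom G) (t : V) (p : unitInterval) (D : Skelφ.StepI.DataNS V) (g : ℕ) (f : ℕ) (yL : Site 2) (σ σT : ℤ) (Nr : ℕ) :
    yL + Skelφ.crossOffX (nL κ Φ t p D g f) (hL κ Φ t p D g f) (vL κ Φ t p D g f) σ σT Nr =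
      yTX0 κ Φ t p D g f yL σT + Skelφ.pt ((σ * ((Nr : ℤ) + 1)) * nL κ Φ t p D g f) ((σ * ((Nr : ℤ) + 1)) * hL κ Φ t p D g f) := by
  unfold yTX0 Skelφ.crossOffX
  funext i
  simp only [Pi.add_apply]
  fin_cases i <;> simp [Skelφ.pt] <;> ring

/-- **THE EXACT SHIFT**: the tangential origin's along reading is the cross-shifted origin's plus `σ·u₀·(Nr+1)`. [folklore] -/
theorem FcA_crossOffX (κ : Consts) {V : Type} [DecidableEq V] [Countable V] {G : SimpleGraph V} [G.LocallyFinite] (Φ : PlanarSkeletonFrmFrom G) (t : V) (p : unitInterval) (D : Skelφ.StepI.DataNS V) (g : ℕ) (f : ℕ) (hN : EqNumL κ Φ t p D g f) (yL : Site 2) (σ σT : ℤ) (Nr : ℕ) :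
    FcA κ Φ t p D g f (yL + Skelφ.crossOffX (nL κ Φ t p D g f) (hL κ Φ t p D g f) (vL κ Φ t p D g f) σ σT Nr) =
      FcA κ Φ t p D g f (yTX0 κ Φ t p D g f yL σT) + σ * u₀A κ Φ t p D g f * ((Nr : ℤ) + 1) := by
  rw [crossOffX_eq, FcA_add_stride κ Φ t p D g f hN]; ring

export PlanarSkeletonNeg.NegB.KS (round_count)

/-- **The tangential choice is admissible**: `σTX = ±1`; `u₁·(N3X+1) ≤ |T1X − F1cA yL| + 2u₁`; and the tangential run ends within one `v`-stride
of the target, `|F1cA yL + σTX·u₁·(N3X+1) − T1X| ≤ u₁` (when the target is at least one stride away; else `N3X = 0` and the error is `< 2u₁`).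
[folklore] -/
theorem N3X_spec (κ : Consts) {V : Type} [DecidableEq V] [Countable V] {G : SimpleGraph V} [G.LocallyFinite] (Φ : PlanarSkeletonFrmFrom G) (t : V) (p : unitInterval) (D : Skelφ.StepI.DataNS V) (g : ℕ) (f : ℕ) (P : PCells2T) (yL x : Site 2) (du : MDir) (z : Site 2) :
    (σTX κ Φ t p D g f P yL x du z = 1 ∨ σTX κ Φ t p D g f P yL x du z = -1) ∧
      u₁A κ Φ t p D g f * ((N3X κ Φ t p D g f P yL x du z : ℤ) + 1) ≤ |T1X P x du z - F1cA κ Φ t p D g f yL| + 2 * u₁A κ Φ t p D g f ∧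
      |F1cA κ Φ t p D g f yL + σTX κ Φ t p D g f P yL x du z * u₁A κ Φ t p D g f * ((N3X κ Φ t p D g f P yL x du z : ℤ) + 1) - T1X P x du z| ≤
        2 * u₁A κ Φ t p D g f := by
  have hu : 1 ≤ u₁A κ Φ t p D g f := (units_eqA κ Φ t p D g f).2.2.2.2.2
  set u := u₁A κ Φ t p D g f
  set T := T1X P x du z
  set F := F1cA κ Φ t p D g f yL
  have hσ : σTX κ Φ t p D g f P yL x du z = 1 ∨ σTX κ Φ t p D g f P yL x du z = -1 := by unfold σTX; split_ifs <;> simp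
  refine ⟨hσ, ?_⟩
  obtain ⟨d1, d2⟩ := PlanarSkeletonNeg.NegB.RootArith.floor_sandwich (x := u) (d := 2) (by norm_num)
  by_cases hfar : u ≤ |T - F|
  · obtain ⟨r1, r2⟩ := round_count (X := |T - F|) (by linarith) hfar
    have hN : (N3X κ Φ t p D g f P yL x du z : ℤ) = ((Int.toNat ((|T - F| + u / 2) / u - 1) : ℕ) : ℤ) := rfl
    rw [hN]
    refine ⟨by linarith, ?_⟩
    set M : ℤ := ((Int.toNat ((|T - F| + u / 2) / u - 1) : ℕ) : ℤ)
    obtain ⟨a1, a2⟩ := abs_le.1 r1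
    unfold σTX
    split_ifs with hle
    · rw [abs_of_nonneg (by linarith : (0:ℤ) ≤ T - F)] at a1 a2
      rw [abs_le]; constructor <;> linarith
    · push Not at hle
      rw [abs_of_neg (by linarith : T - F < 0)] at a1 a2
      rw [abs_le]; constructor <;> linarith
  · -- the target is within one stride: the count is `0`
    push Not at hfar
    obtain ⟨x1, x2⟩ := PlanarSkeletonNeg.NegB.RootArith.floor_sandwich (x := |T - F| + u / 2) (d := u) (by linarith)
    have hY : (|T - F| + u / 2) / u - 1 ≤ 0 := by
      by_contra hc; push Not at hc
      have : u * 2 ≤ u * ((|T - F| + u / 2) / u) := mul_le_mul_of_nonneg_left (by linarith) (by linarith)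
      linarith [abs_nonneg (T - F)]
    have hN : (N3X κ Φ t p D g f P yL x du z : ℤ) = 0 := by
      show ((Int.toNat ((|T - F| + u / 2) / u - 1) : ℕ) : ℤ) = 0
      rw [Int.toNat_of_nonpos hY]; rfl
    rw [hN, zero_add, mul_one]
    refine ⟨by linarith [abs_nonneg (T - F)], ?_⟩
    have hab := abs_le.1 (le_of_lt hfar)
    rcases hσ with h | h <;> rw [h] <;> rw [abs_le] <;> constructor <;> linarith

/-- **The along choice is admissible** (target at least one stride ahead of the cross-shifted origin): the x-run's end reading is within one
stride of the arrival target and the count is bounded by the distance. [cite: KozmaNitzan2024, §4 Lemma 11 (p. 22)] -/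
theorem NrX_spec (κ : Consts) {V : Type} [DecidableEq V] [Countable V] {G : SimpleGraph V} [G.LocallyFinite] (Φ : PlanarSkeletonFrmFrom G) (t : V) (p : unitInterval) (D : Skelφ.StepI.DataNS V) (g : ℕ) (f : ℕ) (P : PCells2T) (hN : EqNumL κ Φ t p D g f) (yL : Site 2) (σT : ℤ) (x : Site 2) (du : MDir) (z : Site 2)
    (hX : u₀A κ Φ t p D g f ≤ sgOf du * (T0X P x du z - FcA κ Φ t p D g f (yTX0 κ Φ t p D g f yL σT))) :
    |FcA κ Φ t p D g f (yL + Skelφ.crossOffX (nL κ Φ t p D g f) (hL κ Φ t p D g f) (vL κ Φ t p D g f) (sgOf du) σT (NrX κ Φ t p D g f P yL σT x du z)) -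
        T0X P x du z| ≤ u₀A κ Φ t p D g f ∧
      u₀A κ Φ t p D g f * ((NrX κ Φ t p D g f P yL σT x du z : ℤ) + 1) ≤
        sgOf du * (T0X P x du z - FcA κ Φ t p D g f (yTX0 κ Φ t p D g f yL σT)) + u₀A κ Φ t p D g f := by
  have hu : 1 ≤ u₀A κ Φ t p D g f := (units_eqA κ Φ t p D g f).2.2.2.2.1
  have hσ : sgOf du = 1 ∨ sgOf du = -1 := sgOf_sign du
  rw [FcA_crossOffX κ Φ t p D g f hN]
  set u := u₀A κ Φ t p D g f
  set T := T0X P x du z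
  set F := FcA κ Φ t p D g f (yTX0 κ Φ t p D g f yL σT)
  obtain ⟨r1, r2⟩ := round_count (X := sgOf du * (T - F)) (by linarith) hX
  have hNr : (NrX κ Φ t p D g f P yL σT x du z : ℤ) = ((Int.toNat ((sgOf du * (T - F) + u / 2) / u - 1) : ℕ) : ℤ) := rfl
  rw [hNr]
  refine ⟨?_, r2⟩
  set M : ℤ := ((Int.toNat ((sgOf du * (T - F) + u / 2) / u - 1) : ℕ) : ℤ)
  obtain ⟨a1, a2⟩ := abs_le.1 r1
  rcases hσ with h | h <;> rw [h] at a1 a2 ⊢ <;> rw [abs_le] <;> constructor <;> linarith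

end FaceCounts

end KS

end NegB

end PlanarSkeletonFrmFrom

end Summit.CriticalPhenomena.PercolationContinuityZ3.Theorems.Transplant

end
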